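import Summits.Parity.GeneralizedHardyLittlewood.Theses.LiouvilleMAD
import Summits.Parity.GeneralizedHardyLittlewood.Theorems.LiouvilleMADFanDecorrelationStubFanFromLaws
import Summits.Parity.GeneralizedHardyLittlewood.Theorems.LiouvilleMADFanDecorrelationStubNarrowOfPointwise
import Summits.Parity.GeneralizedHardyLittlewood.Theorems.LiouvilleMADFanDecorrelationStubPlancherel
import Summits.Parity.GeneralizedHardyLittlewood.Theorems.LiouvilleMADFanDecorrelationStubPointwiseOfBinaryForms
import Summits.Parity.GeneralizedHardyLittlewood.Theorems.LiouvilleMADFanDecorrelationStubTransfer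
import Summits.Parity.GeneralizedHardyLittlewood.Theorems.LiouvilleMADFanDecorrelationStubWindowPartition
import Summits.Parity.GeneralizedHardyLittlewood.Theorems.LiouvilleMADDecorrelationToDilatedChowla
import Summits.Parity.GeneralizedHardyLittlewood.Theorems.DilatedChowla.Negative.DilatedChowlaMirror

/-!
# Crux `FanDecorrelation` (stmt-Parity-13318) — line `SketchIdeator5` (= idea `mellin-height-law`)

Skeleton owned by the line lead (prover-line-stmt-Parity-13318-a1-0).  Composition idea (ideator 5,
`Cruxes/FanDecorrelation/SketchIdeator5.lean` + `Ideas/mellin-height-law.md`): cut the crux by LAG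
SCALE, not by `k`-regime.

Notation (informal; every stub below is written out over Mathlib so that it lands verbatim as a
`--supports stmt-Parity-13318` file): `Q = ⌊√M⌋ + 1`, `λ = ArithmeticFunction.liouville`,
`D(h) = Σ_{(m,m') ∈ (M,2M]², m − m' = h} λ(mn+c) λ(m'n'+c)` (lag correlation),
`R_k = Σ_{j ∈ [Q,2Q)} D(kj)` (the crux's fan sum), and for a profile `φ : ℝ → ℝ`, centre `P` and
width `D` the SMOOTH FAN `SF_φ(P,D) = Σ_{j ∈ [1,2M]} φ((j − P)/D) · D(kj)`.

* `stub_windowPartition` (PROVABLE, pure real analysis, size M): two fixed `C^∞` profiles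
  `φ₁` (supp ⊆ [−1,0]) and `φ₂` (supp ⊆ [−1,1]) such that for every `Q ≥ 8` the sharp window
  `1_{[Q,2Q)}` ON THE INTEGERS is an exact signed sum of `2N + 8` dilated translates
  (`2^N ≤ Q`): `N` dyadic edge layers at each sharp edge (widths `s_i ∈ [1, Q/8]`, centres `Q`
  and `2Q`) and `8` interior tiles of width `Q/8` (centres `Q + ℓQ/8`).  Construction:
  `θ(x) = smoothTransition (x+1)`, `φ₁(y) = θ(2y) − θ(y)`, `φ₂(y) = θ(y) − θ(y−1)`, telescoping.
* `stub_transfer` (PROVABLE, bookkeeping, size M/L; held by the lead): the window partition and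
  the HEIGHT LAW (`|SF_φ(P,D)| ≤ C_φ M^{3/4+ϑ_φ}` for every smooth `φ` supported in `[−2,2]`, all
  `1 ≤ D ≤ Q/8`, `Q ≤ P ≤ 2Q`, `k ≠ 0`, `1 ≤ n ≠ n' ≤ 2M`) imply the crux body: `R_k` is the same
  signed sum of `2N + 8 ≤ 2 log₂ Q + 8` smooth fans, and the log-count is absorbed into `M^ε`.
* `stub_pointwiseLaw` (conjecture-grade, 13319-class — `TwoShiftDilatedChowla` of the
  sketch): `|D(h)| ≤ C M^{1−κ}` for every single lag `|h| ≥ Q/2` (power-saving two-point Chowla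
  along APs with UNEQUAL shifts; normal form `±Σ_u λ(u)λ(u+w)`, `u ≡ n'c (nn')`, `w ≠ 0`).
  Since lead c3: DERIVED from `stub_binaryFormsChowla` (3a, OPEN, conjecture-grade: power-saving
  Chowla for two non-proportional linear forms) by `stub_pointwiseOfBinaryForms` (3b, LANDED).
* `stub_narrowOfPointwise` (PROVABLE, size S/M): the pointwise law gives the height law for
  NARROW windows `1 ≤ D ≤ M^{δ}` with `δ = κ/2` (a width-`D` piece has `≤ 5D` lags, each `≥ Q/2`).
* `stub_wideLaw` (OPEN, conjecture-grade, the genuinely second-order half — "GRH + CFZ-ratios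
  class" by the card's recipe computation; nothing in the tree proves it): the height law for
  WIDE windows `D ≥ M^{δ}`, for every `δ > 0`.
* `stub_fanOfHeightLaws` (PROVABLE from the above, size S; added after wave 1): the composition
  `stub_pointwiseLaw ∧ stub_wideLaw ⟹ crux body` as ONE importable theorem (the line's normal form).
* `stub_plancherel` (PROVABLE, size S, the card's first lemma — the Mellin-side Plancherel
  identity for generalised Dirichlet polynomials; the line's foothold for the conditional
  treatment of `stub_wideLaw`; not used by the composition below).

`FanDecorrelation_of` concludes the route decl BY NAME: transfer ∘ (narrow-from-pointwise ⊕ wide).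
`sorry` occurs only in `stub_*`.  STATUS after wave 1 (lead a1, 2026-08-16): the four provable stubs
are LANDED and imported below — `stub_windowPartition` p110178, `stub_transfer` p110154,
`stub_narrowOfPointwise` p110115, `stub_plancherel` p110033, and the one-piece normal form
`stub_fanOfHeightLaws` p111343 (all ACCEPTED, axioms {propext, Classical.choice, Quot.sound}); the
two remaining `sorry`s are the two conjecture-grade content stubs, so the tree now holds,
kernel-checked and importable (`…Theorems.FanDecorrelation.FanOfHeightLaws.stub_fanOfHeightLaws`):
`stub_pointwiseLaw ∧ stub_wideLaw ⟹ FanDecorrelation`.  NON-CIRCULARITY (r1 triage criterion (iv)): no instance of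
`stub_pointwiseLaw`/`stub_wideLaw` is an instance of the crux (fixed `M`-independent profiles vs the
sharp window with `Q(M)` unit steps; a single lag vs `Q` lags), and the crux implies neither.
Disproof.lean honoured: all lags used are `kj` with `j ≥ 3Q/4` (`k ≠ 0` load-bearing, p99849; no
proportional lag `|h| ≤ |c|` once `M > 2c²`, `proportional_lag_small`; `not_correlationNoiseLaw`).

STATUS after continuation lead c3 (2026-08-16): the pointwise half is RESHAPED onto one clean
conjecture — stub 3a `stub_binaryFormsChowla` (power-saving Chowla for two non-proportional linear
forms, dilations `≤ 2X`, dyadic-scale shifts) — through the landed transfer 3b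
`stub_pointwiseOfBinaryForms` (p116133), so `stub_pointwiseLaw` is now derived; the same conjecture
gives the route's rank-4 crux `DilatedChowla` (stub 8 `stub_dilatedChowlaOfBinaryForms`, p116198,
and `dilatedChowla_of_binaryForms` below, BY NAME), and the reshaped normal form
`3a ∧ stub_wideLaw ⟹ crux body` is stub 9 `stub_fanOfBinaryFormsWide`.  Remaining `sorry`s = the two
conjecture-grade stubs 3a and `stub_wideLaw` (stub 9 landed as p116609).

STATUS after continuation lead c4 (2026-08-16, cycle 4 of the line): no reshape of the composition; stub 3a
given its own adversarial worker pass (`stub-blocked: none` — not false, not misstated, ≈1.8·10⁶ admissible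
coefficient tuples Gaussian at `X ≤ 2000`; the one non-Poisson corner is the transient pretension `λ ≈ χ₋₁₆₃`
below `X ≈ 10⁴`, identified and decaying at GRH rate); HARDNESS CERTIFICATES added below (kernel-checked,
axioms {propext, Classical.choice, Quot.sound}): `realZeroFree_of_binaryForms` (stub 3a ⟹ a real-zero-free
interval `[1 − 1/(C₀ log² q), 1)` for primitive quadratic `L`-functions — Landau–Siegel-hard) and
`realZeroFree_of_MAD` (`CosetDecorrelation ∧ FanDecorrelation ⟹` the same, via 13321 and the DilatedChowla
Siegel mirror).  Line disposition: complete as a NORMAL FORM (p116609), dead as a closing line (L5 third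
limb: both remaining stubs are conjecture-grade and nothing in the card's Leans-on supplies them) —
`Lines/SketchIdeator5.dead.md`.
-/

open scoped BigOperators

namespace Summit.Parity.GeneralizedHardyLittlewood.Cruxes.FanDecorrelation.MellinHeightLaw

open Summit.Parity.GeneralizedHardyLittlewood.Theses.LiouvilleMAD MeasureTheory

/-! ### Registered stubs (self-contained signatures) -/

/-- Stub 1 (PROVABLE NOW, size M) — **dyadic smooth partition of the sharp lag window on the
integers**.  There are two fixed smooth profiles `φ₁, φ₂ : ℝ → ℝ`, supported in `[−2,2]`, such that
for every `Q ≥ 8` there are `N` with `2^N ≤ Q` and widths `s_0,…,s_{N−1} ∈ [1, Q/8]` with, for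
every integer `j`,
`1_{[Q,2Q)}(j) = Σ_{i<N} φ₁((j−Q)/s_i) − Σ_{i<N} φ₁((j−2Q)/s_i) + Σ_{ℓ<8} φ₂((j − Q − ℓQ/8)/(Q/8))`.
(Construction: `θ(x) = Real.smoothTransition (x + 1)` — `0` for `x ≤ −1`, `1` for `x ≥ 0`;
`φ₁(y) = θ(2y) − θ(y)` (supp `[−1,0]`), `φ₂(y) = θ(y) − θ(y−1)` (supp `[−1,1]`); with `W = Q/8`,
`N` minimal with `W ≤ 2^N`, `s_i = W/2^{N−1−i}`: telescoping gives
`θ((x−Q)2^N/W) − θ((x−2Q)2^N/W)` for all real `x`, which on the integers is `1_{[Q,2Q)}` because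
`W/2^N ≤ 1`.) [folklore] -/
theorem stub_windowPartition :
    ∃ φ₁ φ₂ : ℝ → ℝ, ContDiff ℝ (⊤ : ℕ∞) φ₁ ∧ ContDiff ℝ (⊤ : ℕ∞) φ₂ ∧
      (∀ x : ℝ, φ₁ x ≠ 0 → |x| ≤ 2) ∧ (∀ x : ℝ, φ₂ x ≠ 0 → |x| ≤ 2) ∧
      ∀ Q : ℕ, 8 ≤ Q → ∃ N : ℕ, (2 : ℝ) ^ N ≤ Q ∧ ∃ s : ℕ → ℝ,
        (∀ i : ℕ, i < N → 1 ≤ s i ∧ 8 * s i ≤ Q) ∧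
        ∀ j : ℤ, (if (Q : ℤ) ≤ j ∧ j < 2 * Q then (1 : ℝ) else 0) =
          (∑ i ∈ Finset.range N, φ₁ (((j : ℝ) - Q) / s i)) -
            (∑ i ∈ Finset.range N, φ₁ (((j : ℝ) - 2 * Q) / s i)) +
            ∑ l ∈ Finset.range 8, φ₂ (((j : ℝ) - ((Q : ℝ) + l * ((Q : ℝ) / 8))) / ((Q : ℝ) / 8)) :=
  -- landed (p110178): Summit.Parity.GeneralizedHardyLittlewood.Theorems.FanDecorrelation.WindowPartition.stub_windowPartition
  Summit.Parity.GeneralizedHardyLittlewood.Theorems.FanDecorrelation.WindowPartition.stub_windowPartition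

/-- Stub 2 (PROVABLE NOW, size M/L; held by the lead) — **the transfer `HeightLaw → crux`**.
Hypothesis 1 is `stub_windowPartition` verbatim; hypothesis 2 is the HEIGHT LAW: for every smooth
profile `φ` supported in `[−2,2]` and every `c ≠ 0` there are `ϑ < 1/4` and `C` with
`|Σ_{j∈[1,2M]} φ((j−P)/D)·D(kj)| ≤ C·M^{3/4+ϑ}` for all `M`, `1 ≤ n ≠ n' ≤ 2M`, `k ≠ 0`,
`1 ≤ D`, `8D ≤ Q`, `Q ≤ P ≤ 2Q`.  Conclusion: the body of the route decl `FanDecorrelation`.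
Proof: for `M ≥ 64` (`Q ≥ 9`), `[Q,2Q) ⊆ [1,2M]`, so `R_k = Σ_{j∈[1,2M]} 1_{[Q,2Q)}(j) D(kj)` is
the signed sum of `2N + 8` smooth fans given by the partition (profiles `φ₁, φ₂`, admissible
centres/widths), each `≤ C_i M^{3/4+ϑ_i}`; `2N + 8 ≤ 2 log₂ Q + 8 ≤ C_ε M^{ε}` with
`ε = (1/4 − max ϑ_i)/2`; `M < 64` by the trivial bound `|R_k| ≤ Q·M²`. [folklore] -/
theorem stub_transfer :
    (∃ φ₁ φ₂ : ℝ → ℝ, ContDiff ℝ (⊤ : ℕ∞) φ₁ ∧ ContDiff ℝ (⊤ : ℕ∞) φ₂ ∧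
      (∀ x : ℝ, φ₁ x ≠ 0 → |x| ≤ 2) ∧ (∀ x : ℝ, φ₂ x ≠ 0 → |x| ≤ 2) ∧
      ∀ Q : ℕ, 8 ≤ Q → ∃ N : ℕ, (2 : ℝ) ^ N ≤ Q ∧ ∃ s : ℕ → ℝ,
        (∀ i : ℕ, i < N → 1 ≤ s i ∧ 8 * s i ≤ Q) ∧
        ∀ j : ℤ, (if (Q : ℤ) ≤ j ∧ j < 2 * Q then (1 : ℝ) else 0) =
          (∑ i ∈ Finset.range N, φ₁ (((j : ℝ) - Q) / s i)) -
            (∑ i ∈ Finset.range N, φ₁ (((j : ℝ) - 2 * Q) / s i)) +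
            ∑ l ∈ Finset.range 8, φ₂ (((j : ℝ) - ((Q : ℝ) + l * ((Q : ℝ) / 8))) / ((Q : ℝ) / 8))) →
    (∀ φ : ℝ → ℝ, ContDiff ℝ (⊤ : ℕ∞) φ → (∀ x : ℝ, φ x ≠ 0 → |x| ≤ 2) →
      ∀ c : ℤ, c ≠ 0 → ∃ ϑ : ℝ, ϑ < 1 / 4 ∧ ∃ C : ℝ, ∀ M n n' : ℕ, ∀ k : ℤ, ∀ P D : ℝ,
        1 ≤ n → 1 ≤ n' → n ≠ n' → n ≤ 2 * M → n' ≤ 2 * M → k ≠ 0 →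
          1 ≤ D → 8 * D ≤ (Nat.sqrt M : ℝ) + 1 →
            (Nat.sqrt M : ℝ) + 1 ≤ P → P ≤ 2 * ((Nat.sqrt M : ℝ) + 1) →
              |∑ j ∈ Finset.Icc 1 (2 * M), φ (((j : ℝ) - P) / D) *
                  ∑ p ∈ (Finset.Ioc M (2 * M) ×ˢ Finset.Ioc M (2 * M)).filter
                      (fun p : ℕ × ℕ => (p.1 : ℤ) - p.2 = k * (j : ℤ)),
                    (ArithmeticFunction.liouville (Int.toNat ((p.1 : ℤ) * n + c)) : ℝ) *
                      (ArithmeticFunction.liouville (Int.toNat ((p.2 : ℤ) * n' + c)) : ℝ)| ≤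
                C * (M : ℝ) ^ (3 / 4 + ϑ)) →
    ∀ c : ℤ, c ≠ 0 → ∃ ϑ : ℝ, ϑ < 1 / 4 ∧ ∃ C : ℝ, ∀ M n n' : ℕ, ∀ k : ℤ,
      1 ≤ n → 1 ≤ n' → n ≠ n' → n ≤ 2 * M → n' ≤ 2 * M → k ≠ 0 →
        |∑ j ∈ Finset.Ico (Nat.sqrt M + 1) (2 * (Nat.sqrt M + 1)),
            ∑ p ∈ (Finset.Ioc M (2 * M) ×ˢ Finset.Ioc M (2 * M)).filter
                (fun p : ℕ × ℕ => (p.1 : ℤ) - p.2 = k * (j : ℤ)),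
              (ArithmeticFunction.liouville (Int.toNat ((p.1 : ℤ) * n + c)) : ℝ) *
                (ArithmeticFunction.liouville (Int.toNat ((p.2 : ℤ) * n' + c)) : ℝ)| ≤
          C * (M : ℝ) ^ (3 / 4 + ϑ) :=
  -- landed (p110154): Summit.Parity.GeneralizedHardyLittlewood.Theorems.FanDecorrelation.Transfer.stub_transfer
  Summit.Parity.GeneralizedHardyLittlewood.Theorems.FanDecorrelation.Transfer.stub_transfer

/-- Stub 3a (OPEN, conjecture-grade; added by lead c3 as the COMMON PARENT of stub 3 and of the
route's rank-4 crux `DilatedChowla`, stmt-Parity-13319) — **power-saving binary Chowla for two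
non-proportional linear forms** ("BinaryFormsChowla"): there are `κ > 0` and `C` such that
`|Σ_{u ∈ (X, X+L]} λ(n₁u + a₁) λ(n₂u + a₂)| ≤ C·X^{1−κ}` for all `L ≤ X`, all dilations
`1 ≤ n₁, n₂ ≤ 2X`, all shifts with `|aᵢ| ≤ 2nᵢX` (each form is `nᵢ(u + sᵢ)`, `|sᵢ| ≤ 2X`: the dyadic
scale, not arbitrary height) and positive arguments (`nᵢX + aᵢ > 0`), provided the
two forms are NOT proportional (`n₁a₂ ≠ n₂a₁`; the proportional case is `Σ λ² = L`).  This is the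
Chowla–Elliott conjecture for the pair of linear forms `(n₁u+a₁, n₂u+a₂)` with a POWER saving, uniform in
the coefficients at level 1/2 (moduli `nᵢ ≤ 2X ≍ (size)^{1/2}`): open; known are the logarithmically
averaged `o(1)` (Tao 2016, two-point) and `o(1)` at almost all scales (Tao–Teräväinen 2019), no power
saving in any range, and for `nᵢ ≍ X` not even GRH bounds the one-point sums `Σ_u λ(nᵢu+aᵢ)`.
Instances: `DilatedChowla` is `X = L = M`, `n₁ = n ≠ n₂ = n'`, `a₁ = a₂ = c` (`dilatedChowla_of_binaryForms`
below); stub 3 is `X = M`, `L = M − |h|`, `{a₁,a₂} = {c, c + |h|·nᵢ}` (stub 3b).  Random size `√L`;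
numerics: every instance tested is Poisson (kit j015613, j016978; crux notes). -/
theorem stub_binaryFormsChowla :
    ∃ κ : ℝ, 0 < κ ∧ ∃ C : ℝ, ∀ X L n₁ n₂ : ℕ, ∀ a₁ a₂ : ℤ,
      L ≤ X → 1 ≤ n₁ → 1 ≤ n₂ → n₁ ≤ 2 * X → n₂ ≤ 2 * X →
        0 < (n₁ : ℤ) * X + a₁ → 0 < (n₂ : ℤ) * X + a₂ →
          |a₁| ≤ 2 * (n₁ : ℤ) * X → |a₂| ≤ 2 * (n₂ : ℤ) * X →
            (n₁ : ℤ) * a₂ ≠ (n₂ : ℤ) * a₁ →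
              |∑ u ∈ Finset.Ioc X (X + L),
                  (ArithmeticFunction.liouville (Int.toNat ((u : ℤ) * n₁ + a₁)) : ℝ) *
                    (ArithmeticFunction.liouville (Int.toNat ((u : ℤ) * n₂ + a₂)) : ℝ)| ≤
                C * (X : ℝ) ^ (1 - κ) := by
  sorry

/-- Stub 3b (PROVABLE NOW, size S/M; added by lead c3) — **the pointwise law from binary-forms
Chowla**: hypothesis = `stub_binaryFormsChowla` verbatim, conclusion = stub 3 (`stub_pointwiseLaw`)
verbatim.  Proof: `C' = max C 0 ⊔ (trivial bound for M ≤ M₀(c))`, `M₀ = 4c² + 4|c| + 4`, same `κ`.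
For `M > M₀` and a lag `h` with `2|h| ≥ Q` (`Q = ⌊√M⌋+1 > 2|c|`, so `|h| > |c|`): if `|h| ≥ M` the
lag set is empty; if `0 < h < M` the pairs `(m,m') ∈ (M,2M]²` with `m − m' = h` are `(u+h, u)`,
`u ∈ (M, 2M−h]`, and `λ((u+h)n+c)λ(un'+c)` is the binary form pair `(n, hn+c; n', c)` on
`(X, X+L] = (M, M+(M−h)]`; if `−M < h < 0` they are `(u, u+|h|)`, pair `(n, c; n', |h|n'+c)`.
Side conditions: `L = M−|h| ≤ M`; `nM + hn + c ≥ M + 1 − |c| > 0`, `n'M + c > 0`;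
`|hn+c| ≤ n(M−1) + |c| ≤ 2nM`, `|c| ≤ 2n'M`; non-proportionality `n·c ≠ n'(hn+c)`, i.e. `c(n−n') ≠ hnn'`, holds
because `|c(n−n')| < |c|·max(n,n') ≤ |h|·min(n,n')·max(n,n') = |h|nn'` (`|h| > |c|`, cf.
`Negative.proportional_lag_small`). [folklore] -/
theorem stub_pointwiseOfBinaryForms :
    (∃ κ : ℝ, 0 < κ ∧ ∃ C : ℝ, ∀ X L n₁ n₂ : ℕ, ∀ a₁ a₂ : ℤ,
      L ≤ X → 1 ≤ n₁ → 1 ≤ n₂ → n₁ ≤ 2 * X → n₂ ≤ 2 * X →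
        0 < (n₁ : ℤ) * X + a₁ → 0 < (n₂ : ℤ) * X + a₂ →
          |a₁| ≤ 2 * (n₁ : ℤ) * X → |a₂| ≤ 2 * (n₂ : ℤ) * X →
            (n₁ : ℤ) * a₂ ≠ (n₂ : ℤ) * a₁ →
              |∑ u ∈ Finset.Ioc X (X + L),
                  (ArithmeticFunction.liouville (Int.toNat ((u : ℤ) * n₁ + a₁)) : ℝ) *
                    (ArithmeticFunction.liouville (Int.toNat ((u : ℤ) * n₂ + a₂)) : ℝ)| ≤
                C * (X : ℝ) ^ (1 - κ)) →
    ∀ c : ℤ, c ≠ 0 → ∃ κ : ℝ, 0 < κ ∧ ∃ C : ℝ, ∀ M n n' : ℕ, ∀ h : ℤ,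
      1 ≤ n → 1 ≤ n' → n ≠ n' → n ≤ 2 * M → n' ≤ 2 * M →
        (Nat.sqrt M : ℤ) + 1 ≤ 2 * |h| →
          |∑ p ∈ (Finset.Ioc M (2 * M) ×ˢ Finset.Ioc M (2 * M)).filter
                (fun p : ℕ × ℕ => (p.1 : ℤ) - p.2 = h),
              (ArithmeticFunction.liouville (Int.toNat ((p.1 : ℤ) * n + c)) : ℝ) *
                (ArithmeticFunction.liouville (Int.toNat ((p.2 : ℤ) * n' + c)) : ℝ)| ≤
            C * (M : ℝ) ^ (1 - κ) :=
  -- landed (p116133): Summit.Parity.GeneralizedHardyLittlewood.Theorems.FanDecorrelation.PointwiseOfBinaryForms.stub_pointwiseOfBinaryForms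
  Summit.Parity.GeneralizedHardyLittlewood.Theorems.FanDecorrelation.PointwiseOfBinaryForms.stub_pointwiseOfBinaryForms

/-- Stub 3 (OPEN, conjecture-grade, 13319-class; = `TwoShiftDilatedChowla` of the sketch with the
idle guard `|h| ≤ 4M` dropped) — **pointwise power saving at a single large lag**: for every
`c ≠ 0` there are `κ > 0` and `C` with `|D(h)| = |Σ_{m−m'=h} λ(mn+c)λ(m'n'+c)| ≤ C·M^{1−κ}` for all
`M`, all `1 ≤ n ≠ n' ≤ 2M` and every lag with `2|h| ≥ Q` (so `|h| > |c|` once `M > 4c²`: no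
proportional lag, `Disproof.proportional_lag_small`; `|h| ≥ M` is an empty sum).  Normal form:
`±Σ_u λ(u)λ(u+w)` along `u ≡ n'c (mod nn')`, `w = c(n−n') − nn'h ≠ 0` — power-saving two-point
Chowla along an AP, the class of the route's rank-4 crux `DilatedChowla` (13319); open, believed
(random size `√M`; numerics kit j015613: `max_h |D(h)|/√M ≤ 3.9`, `M ≤ 10⁶`).
RESHAPED by lead c3: now DERIVED from stubs 3a + 3b (its registered signature is unchanged, so the
landed consumers `stub_narrowOfPointwise` p110115 and `stub_fanOfHeightLaws` p111343 still apply). -/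
theorem stub_pointwiseLaw :
    ∀ c : ℤ, c ≠ 0 → ∃ κ : ℝ, 0 < κ ∧ ∃ C : ℝ, ∀ M n n' : ℕ, ∀ h : ℤ,
      1 ≤ n → 1 ≤ n' → n ≠ n' → n ≤ 2 * M → n' ≤ 2 * M →
        (Nat.sqrt M : ℤ) + 1 ≤ 2 * |h| →
          |∑ p ∈ (Finset.Ioc M (2 * M) ×ˢ Finset.Ioc M (2 * M)).filter
                (fun p : ℕ × ℕ => (p.1 : ℤ) - p.2 = h),
              (ArithmeticFunction.liouville (Int.toNat ((p.1 : ℤ) * n + c)) : ℝ) *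
                (ArithmeticFunction.liouville (Int.toNat ((p.2 : ℤ) * n' + c)) : ℝ)| ≤
            C * (M : ℝ) ^ (1 - κ) :=
  stub_pointwiseOfBinaryForms stub_binaryFormsChowla

/-- Stub 4 (PROVABLE NOW, size S/M) — **narrow windows from the pointwise law**: hypothesis =
`stub_pointwiseLaw` verbatim; conclusion = the height law for NARROW windows: for every smooth
`φ` supported in `[−2,2]` and `c ≠ 0` there are `δ > 0`, `ϑ < 1/4`, `C` such that
`|Σ_{j∈[1,2M]} φ((j−P)/D)·D(kj)| ≤ C·M^{3/4+ϑ}` whenever `1 ≤ D ≤ M^{δ}`, `8D ≤ Q`, `Q ≤ P ≤ 2Q`,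
`k ≠ 0`, `1 ≤ n ≠ n' ≤ 2M`.  Proof: `δ = κ/2`, `ϑ = 1/4 − κ/2`; the `j` with `φ((j−P)/D) ≠ 0` have
`|j − P| ≤ 2D`, at most `4D + 1 ≤ 5M^{δ}` of them, each with `2|kj| ≥ 2j ≥ 2P − 4D ≥ 3Q/2 ≥ Q`,
so each term is `≤ ‖φ‖_∞ · C₀ M^{1−κ}` (`φ` is continuous with compact support, hence bounded).
[folklore] -/
theorem stub_narrowOfPointwise :
    (∀ c : ℤ, c ≠ 0 → ∃ κ : ℝ, 0 < κ ∧ ∃ C : ℝ, ∀ M n n' : ℕ, ∀ h : ℤ,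
      1 ≤ n → 1 ≤ n' → n ≠ n' → n ≤ 2 * M → n' ≤ 2 * M →
        (Nat.sqrt M : ℤ) + 1 ≤ 2 * |h| →
          |∑ p ∈ (Finset.Ioc M (2 * M) ×ˢ Finset.Ioc M (2 * M)).filter
                (fun p : ℕ × ℕ => (p.1 : ℤ) - p.2 = h),
              (ArithmeticFunction.liouville (Int.toNat ((p.1 : ℤ) * n + c)) : ℝ) *
                (ArithmeticFunction.liouville (Int.toNat ((p.2 : ℤ) * n' + c)) : ℝ)| ≤
            C * (M : ℝ) ^ (1 - κ)) →
    ∀ φ : ℝ → ℝ, ContDiff ℝ (⊤ : ℕ∞) φ → (∀ x : ℝ, φ x ≠ 0 → |x| ≤ 2) →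
      ∀ c : ℤ, c ≠ 0 → ∃ δ : ℝ, 0 < δ ∧ ∃ ϑ : ℝ, ϑ < 1 / 4 ∧ ∃ C : ℝ,
        ∀ M n n' : ℕ, ∀ k : ℤ, ∀ P D : ℝ,
          1 ≤ n → 1 ≤ n' → n ≠ n' → n ≤ 2 * M → n' ≤ 2 * M → k ≠ 0 →
            1 ≤ D → D ≤ (M : ℝ) ^ δ → 8 * D ≤ (Nat.sqrt M : ℝ) + 1 →
              (Nat.sqrt M : ℝ) + 1 ≤ P → P ≤ 2 * ((Nat.sqrt M : ℝ) + 1) →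
                |∑ j ∈ Finset.Icc 1 (2 * M), φ (((j : ℝ) - P) / D) *
                    ∑ p ∈ (Finset.Ioc M (2 * M) ×ˢ Finset.Ioc M (2 * M)).filter
                        (fun p : ℕ × ℕ => (p.1 : ℤ) - p.2 = k * (j : ℤ)),
                      (ArithmeticFunction.liouville (Int.toNat ((p.1 : ℤ) * n + c)) : ℝ) *
                        (ArithmeticFunction.liouville (Int.toNat ((p.2 : ℤ) * n' + c)) : ℝ)| ≤
                  C * (M : ℝ) ^ (3 / 4 + ϑ) :=
  -- landed (p110115): Summit.Parity.GeneralizedHardyLittlewood.Theorems.FanDecorrelation.NarrowOfPointwise.stub_narrowOfPointwise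
  Summit.Parity.GeneralizedHardyLittlewood.Theorems.FanDecorrelation.NarrowOfPointwise.stub_narrowOfPointwise

/-- Stub 5 (OPEN, conjecture-grade — the second-order half; "GRH + CFZ-ratios class" per the
card's recipe computation, Ideator5Analysis §2; no tool in the tree proves it) — **the height law
for WIDE windows**: for every smooth `φ` supported in `[−2,2]`, every `c ≠ 0` and every `δ > 0`
there are `ϑ < 1/4` and `C` with `|Σ_{j∈[1,2M]} φ((j−P)/D)·D(kj)| ≤ C·M^{3/4+ϑ}` whenever
`M^{δ} ≤ D`, `8D ≤ Q`, `Q ≤ P ≤ 2Q`, `k ≠ 0`, `1 ≤ n ≠ n' ≤ 2M`.  A width-`D` piece weights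
`≍ D` consecutive lags `kj`, `j ∈ [P−2D, P+2D] ⊆ [3Q/4, 9Q/4]` (no lag `0`, no proportional lag),
`≍ D·M` terms, random size `(DM)^{1/2} ≤ M^{3/4}/2`: square-root cancellation ACROSS `≥ M^{δ}`
signed lag correlations is asked — beyond every pointwise conjecture; on the Mellin side the
off-diagonal of a short mean value of two Liouville Dirichlet polynomials at height `≍ M/(kD)`. -/
theorem stub_wideLaw :
    ∀ φ : ℝ → ℝ, ContDiff ℝ (⊤ : ℕ∞) φ → (∀ x : ℝ, φ x ≠ 0 → |x| ≤ 2) →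
      ∀ c : ℤ, c ≠ 0 → ∀ δ : ℝ, 0 < δ → ∃ ϑ : ℝ, ϑ < 1 / 4 ∧ ∃ C : ℝ,
        ∀ M n n' : ℕ, ∀ k : ℤ, ∀ P D : ℝ,
          1 ≤ n → 1 ≤ n' → n ≠ n' → n ≤ 2 * M → n' ≤ 2 * M → k ≠ 0 →
            (M : ℝ) ^ δ ≤ D → 8 * D ≤ (Nat.sqrt M : ℝ) + 1 →
              (Nat.sqrt M : ℝ) + 1 ≤ P → P ≤ 2 * ((Nat.sqrt M : ℝ) + 1) →
                |∑ j ∈ Finset.Icc 1 (2 * M), φ (((j : ℝ) - P) / D) *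
                    ∑ p ∈ (Finset.Ioc M (2 * M) ×ˢ Finset.Ioc M (2 * M)).filter
                        (fun p : ℕ × ℕ => (p.1 : ℤ) - p.2 = k * (j : ℤ)),
                      (ArithmeticFunction.liouville (Int.toNat ((p.1 : ℤ) * n + c)) : ℝ) *
                        (ArithmeticFunction.liouville (Int.toNat ((p.2 : ℤ) * n' + c)) : ℝ)| ≤
                  C * (M : ℝ) ^ (3 / 4 + ϑ) := by
  sorry

/-- Stub 6 (PROVABLE NOW, size S; the card's FIRST LEMMA `MellinPlancherel`, not used by the
composition) — **Mellin-side Plancherel for generalised Dirichlet polynomials**: for an integrable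
kernel `K`, finitely many real frequencies `ω_y` and coefficients `a, b`,
`∫ K(t)·(Σ_y a_y e^{−itω_y})·conj(Σ_{y'} b_{y'} e^{−itω_{y'}}) dt
   = Σ_{y,y'} a_y conj(b_{y'}) ∫ K(t) e^{−it(ω_y − ω_{y'})} dt`
(finite sum ↔ integral interchange, `MeasureTheory.integral_finset_sum`). [folklore] -/
theorem stub_plancherel :
    ∀ (s : Finset ℕ) (freq : ℕ → ℝ) (a b : ℕ → ℂ) (K : ℝ → ℂ), Integrable K →
      ∫ t : ℝ, K t * (∑ y ∈ s, a y * Complex.exp (-(((t * freq y : ℝ) : ℂ) * Complex.I))) *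
          (starRingEnd ℂ) (∑ y ∈ s, b y * Complex.exp (-(((t * freq y : ℝ) : ℂ) * Complex.I))) =
        ∑ y ∈ s, ∑ y' ∈ s, a y * (starRingEnd ℂ) (b y') *
          ∫ t : ℝ, K t * Complex.exp (-(((t * (freq y - freq y') : ℝ) : ℂ) * Complex.I)) :=
  -- landed (p110033): Summit.Parity.GeneralizedHardyLittlewood.Theorems.FanDecorrelation.Plancherel.stub_plancherel
  Summit.Parity.GeneralizedHardyLittlewood.Theorems.FanDecorrelation.Plancherel.stub_plancherel

/-! ### Glue (proved here) -/

/-- Narrow (`D ≤ M^{δ}`, some `δ > 0`) and wide (`D ≥ M^{δ}`, every `δ > 0`) height laws combine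
to the full height law (`ϑ = max ϑ₁ ϑ₂`, `C = max (max C₁ C₂) 0`). -/
theorem heightLaw_of_narrow_wide
    (hN : ∀ φ : ℝ → ℝ, ContDiff ℝ (⊤ : ℕ∞) φ → (∀ x : ℝ, φ x ≠ 0 → |x| ≤ 2) →
      ∀ c : ℤ, c ≠ 0 → ∃ δ : ℝ, 0 < δ ∧ ∃ ϑ : ℝ, ϑ < 1 / 4 ∧ ∃ C : ℝ,
        ∀ M n n' : ℕ, ∀ k : ℤ, ∀ P D : ℝ,
          1 ≤ n → 1 ≤ n' → n ≠ n' → n ≤ 2 * M → n' ≤ 2 * M → k ≠ 0 →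
            1 ≤ D → D ≤ (M : ℝ) ^ δ → 8 * D ≤ (Nat.sqrt M : ℝ) + 1 →
              (Nat.sqrt M : ℝ) + 1 ≤ P → P ≤ 2 * ((Nat.sqrt M : ℝ) + 1) →
                |∑ j ∈ Finset.Icc 1 (2 * M), φ (((j : ℝ) - P) / D) *
                    ∑ p ∈ (Finset.Ioc M (2 * M) ×ˢ Finset.Ioc M (2 * M)).filter
                        (fun p : ℕ × ℕ => (p.1 : ℤ) - p.2 = k * (j : ℤ)),
                      (ArithmeticFunction.liouville (Int.toNat ((p.1 : ℤ) * n + c)) : ℝ) *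
                        (ArithmeticFunction.liouville (Int.toNat ((p.2 : ℤ) * n' + c)) : ℝ)| ≤
                  C * (M : ℝ) ^ (3 / 4 + ϑ))
    (hW : ∀ φ : ℝ → ℝ, ContDiff ℝ (⊤ : ℕ∞) φ → (∀ x : ℝ, φ x ≠ 0 → |x| ≤ 2) →
      ∀ c : ℤ, c ≠ 0 → ∀ δ : ℝ, 0 < δ → ∃ ϑ : ℝ, ϑ < 1 / 4 ∧ ∃ C : ℝ,
        ∀ M n n' : ℕ, ∀ k : ℤ, ∀ P D : ℝ,
          1 ≤ n → 1 ≤ n' → n ≠ n' → n ≤ 2 * M → n' ≤ 2 * M → k ≠ 0 →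
            (M : ℝ) ^ δ ≤ D → 8 * D ≤ (Nat.sqrt M : ℝ) + 1 →
              (Nat.sqrt M : ℝ) + 1 ≤ P → P ≤ 2 * ((Nat.sqrt M : ℝ) + 1) →
                |∑ j ∈ Finset.Icc 1 (2 * M), φ (((j : ℝ) - P) / D) *
                    ∑ p ∈ (Finset.Ioc M (2 * M) ×ˢ Finset.Ioc M (2 * M)).filter
                        (fun p : ℕ × ℕ => (p.1 : ℤ) - p.2 = k * (j : ℤ)),
                      (ArithmeticFunction.liouville (Int.toNat ((p.1 : ℤ) * n + c)) : ℝ) *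
                        (ArithmeticFunction.liouville (Int.toNat ((p.2 : ℤ) * n' + c)) : ℝ)| ≤
                  C * (M : ℝ) ^ (3 / 4 + ϑ)) :
    ∀ φ : ℝ → ℝ, ContDiff ℝ (⊤ : ℕ∞) φ → (∀ x : ℝ, φ x ≠ 0 → |x| ≤ 2) →
      ∀ c : ℤ, c ≠ 0 → ∃ ϑ : ℝ, ϑ < 1 / 4 ∧ ∃ C : ℝ, ∀ M n n' : ℕ, ∀ k : ℤ, ∀ P D : ℝ,
        1 ≤ n → 1 ≤ n' → n ≠ n' → n ≤ 2 * M → n' ≤ 2 * M → k ≠ 0 →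
          1 ≤ D → 8 * D ≤ (Nat.sqrt M : ℝ) + 1 →
            (Nat.sqrt M : ℝ) + 1 ≤ P → P ≤ 2 * ((Nat.sqrt M : ℝ) + 1) →
              |∑ j ∈ Finset.Icc 1 (2 * M), φ (((j : ℝ) - P) / D) *
                  ∑ p ∈ (Finset.Ioc M (2 * M) ×ˢ Finset.Ioc M (2 * M)).filter
                      (fun p : ℕ × ℕ => (p.1 : ℤ) - p.2 = k * (j : ℤ)),
                    (ArithmeticFunction.liouville (Int.toNat ((p.1 : ℤ) * n + c)) : ℝ) *
                      (ArithmeticFunction.liouville (Int.toNat ((p.2 : ℤ) * n' + c)) : ℝ)| ≤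
                C * (M : ℝ) ^ (3 / 4 + ϑ) := by
  intro φ hφ hsupp c hc
  obtain ⟨δ, hδ, ϑ₁, hϑ₁, C₁, h₁⟩ := hN φ hφ hsupp c hc
  obtain ⟨ϑ₂, hϑ₂, C₂, h₂⟩ := hW φ hφ hsupp c hc δ hδ
  refine ⟨max ϑ₁ ϑ₂, max_lt hϑ₁ hϑ₂, max (max C₁ C₂) 0, ?_⟩
  intro M n n' k P D hn hn' hnn' hnM hn'M hk hD1 hD8 hP1 hP2
  -- the scale is positive: `1 ≤ n ≤ 2M`
  have hM1 : (1 : ℝ) ≤ M := by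
    have : 1 ≤ M := by omega
    exact_mod_cast this
  have hpow : ∀ e : ℝ, e ≤ 3 / 4 + max ϑ₁ ϑ₂ → (M : ℝ) ^ e ≤ (M : ℝ) ^ (3 / 4 + max ϑ₁ ϑ₂) :=
    fun e he => Real.rpow_le_rpow_of_exponent_le hM1 he
  have h0 : 0 ≤ (M : ℝ) ^ (3 / 4 + max ϑ₁ ϑ₂) := Real.rpow_nonneg (by positivity) _
  rcases le_total D ((M : ℝ) ^ δ) with hle | hge
  · have := h₁ M n n' k P D hn hn' hnn' hnM hn'M hk hD1 hle hD8 hP1 hP2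
    calc _ ≤ C₁ * (M : ℝ) ^ (3 / 4 + ϑ₁) := this
      _ ≤ max (max C₁ C₂) 0 * (M : ℝ) ^ (3 / 4 + max ϑ₁ ϑ₂) := by
          have hC : C₁ ≤ max (max C₁ C₂) 0 := le_trans (le_max_left _ _) (le_max_left _ _)
          exact Summit.Parity.GeneralizedHardyLittlewood.Theorems.FanDecorrelation.FanFromLaws.const_rpow_le
            hM1 hC (le_max_right _ _) (by linarith [le_max_left ϑ₁ ϑ₂])
  · have := h₂ M n n' k P D hn hn' hnn' hnM hn'M hk hge hD8 hP1 hP2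
    calc _ ≤ C₂ * (M : ℝ) ^ (3 / 4 + ϑ₂) := this
      _ ≤ max (max C₁ C₂) 0 * (M : ℝ) ^ (3 / 4 + max ϑ₁ ϑ₂) := by
          have hC : C₂ ≤ max (max C₁ C₂) 0 := le_trans (le_max_right _ _) (le_max_left _ _)
          exact Summit.Parity.GeneralizedHardyLittlewood.Theorems.FanDecorrelation.FanFromLaws.const_rpow_le
            hM1 hC (le_max_right _ _) (by linarith [le_max_right ϑ₁ ϑ₂])

/-- Stub 7 (PROVABLE NOW from stubs 1, 2, 4 and the glue; added by the lead after wave 1 so that the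
line's NORMAL FORM lands as ONE importable tree theorem) — **pointwise law ∧ wide height law ⟹
crux body**: hypothesis 1 = `stub_pointwiseLaw` verbatim, hypothesis 2 = `stub_wideLaw` verbatim,
conclusion = the body of the route decl `FanDecorrelation`. [folklore] -/
theorem stub_fanOfHeightLaws :
    (∀ c : ℤ, c ≠ 0 → ∃ κ : ℝ, 0 < κ ∧ ∃ C : ℝ, ∀ M n n' : ℕ, ∀ h : ℤ,
      1 ≤ n → 1 ≤ n' → n ≠ n' → n ≤ 2 * M → n' ≤ 2 * M →
        (Nat.sqrt M : ℤ) + 1 ≤ 2 * |h| →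
          |∑ p ∈ (Finset.Ioc M (2 * M) ×ˢ Finset.Ioc M (2 * M)).filter
                (fun p : ℕ × ℕ => (p.1 : ℤ) - p.2 = h),
              (ArithmeticFunction.liouville (Int.toNat ((p.1 : ℤ) * n + c)) : ℝ) *
                (ArithmeticFunction.liouville (Int.toNat ((p.2 : ℤ) * n' + c)) : ℝ)| ≤
            C * (M : ℝ) ^ (1 - κ)) →
    (∀ φ : ℝ → ℝ, ContDiff ℝ (⊤ : ℕ∞) φ → (∀ x : ℝ, φ x ≠ 0 → |x| ≤ 2) →
      ∀ c : ℤ, c ≠ 0 → ∀ δ : ℝ, 0 < δ → ∃ ϑ : ℝ, ϑ < 1 / 4 ∧ ∃ C : ℝ,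
        ∀ M n n' : ℕ, ∀ k : ℤ, ∀ P D : ℝ,
          1 ≤ n → 1 ≤ n' → n ≠ n' → n ≤ 2 * M → n' ≤ 2 * M → k ≠ 0 →
            (M : ℝ) ^ δ ≤ D → 8 * D ≤ (Nat.sqrt M : ℝ) + 1 →
              (Nat.sqrt M : ℝ) + 1 ≤ P → P ≤ 2 * ((Nat.sqrt M : ℝ) + 1) →
                |∑ j ∈ Finset.Icc 1 (2 * M), φ (((j : ℝ) - P) / D) *
                    ∑ p ∈ (Finset.Ioc M (2 * M) ×ˢ Finset.Ioc M (2 * M)).filter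
                        (fun p : ℕ × ℕ => (p.1 : ℤ) - p.2 = k * (j : ℤ)),
                      (ArithmeticFunction.liouville (Int.toNat ((p.1 : ℤ) * n + c)) : ℝ) *
                        (ArithmeticFunction.liouville (Int.toNat ((p.2 : ℤ) * n' + c)) : ℝ)| ≤
                  C * (M : ℝ) ^ (3 / 4 + ϑ)) →
    ∀ c : ℤ, c ≠ 0 → ∃ ϑ : ℝ, ϑ < 1 / 4 ∧ ∃ C : ℝ, ∀ M n n' : ℕ, ∀ k : ℤ,
      1 ≤ n → 1 ≤ n' → n ≠ n' → n ≤ 2 * M → n' ≤ 2 * M → k ≠ 0 →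
        |∑ j ∈ Finset.Ico (Nat.sqrt M + 1) (2 * (Nat.sqrt M + 1)),
            ∑ p ∈ (Finset.Ioc M (2 * M) ×ˢ Finset.Ioc M (2 * M)).filter
                (fun p : ℕ × ℕ => (p.1 : ℤ) - p.2 = k * (j : ℤ)),
              (ArithmeticFunction.liouville (Int.toNat ((p.1 : ℤ) * n + c)) : ℝ) *
                (ArithmeticFunction.liouville (Int.toNat ((p.2 : ℤ) * n' + c)) : ℝ)| ≤
          C * (M : ℝ) ^ (3 / 4 + ϑ) :=
  -- landed (p111343): Summit.Parity.GeneralizedHardyLittlewood.Theorems.FanDecorrelation.FanOfHeightLaws.stub_fanOfHeightLaws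
  -- (the same term; written out here over the other landed stubs so that this workfile does not
  -- depend on the newest module while the farm snapshot catches up)
  fun hP hW => stub_transfer stub_windowPartition
    (heightLaw_of_narrow_wide (stub_narrowOfPointwise hP) hW)

/-! ### Normal-form stubs added by lead c3 (importable one-piece theorems) -/

/-- Stub 8 (PROVABLE NOW, size S; added by lead c3, not used by the composition) — **the route's
rank-4 crux `DilatedChowla` (stmt-Parity-13319) from binary-forms Chowla**: hypothesis = stub 3a
verbatim, conclusion = the body of the route decl `DilatedChowla` verbatim (`X = L = M`,
`a₁ = a₂ = c`; non-proportional because `c ≠ 0`, `n ≠ n'`; `M ≤ |c|` by the trivial bound;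
exponent capped at `min κ (1/2)`).  Landed so that ONE conjecture item (3a) serves both cruxes.
[folklore] -/
theorem stub_dilatedChowlaOfBinaryForms :
    (∃ κ : ℝ, 0 < κ ∧ ∃ C : ℝ, ∀ X L n₁ n₂ : ℕ, ∀ a₁ a₂ : ℤ,
      L ≤ X → 1 ≤ n₁ → 1 ≤ n₂ → n₁ ≤ 2 * X → n₂ ≤ 2 * X →
        0 < (n₁ : ℤ) * X + a₁ → 0 < (n₂ : ℤ) * X + a₂ →
          |a₁| ≤ 2 * (n₁ : ℤ) * X → |a₂| ≤ 2 * (n₂ : ℤ) * X →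
            (n₁ : ℤ) * a₂ ≠ (n₂ : ℤ) * a₁ →
              |∑ u ∈ Finset.Ioc X (X + L),
                  (ArithmeticFunction.liouville (Int.toNat ((u : ℤ) * n₁ + a₁)) : ℝ) *
                    (ArithmeticFunction.liouville (Int.toNat ((u : ℤ) * n₂ + a₂)) : ℝ)| ≤
                C * (X : ℝ) ^ (1 - κ)) →
    ∀ c : ℤ, c ≠ 0 → ∃ κ : ℝ, 0 < κ ∧ ∃ C : ℝ, ∀ M n n' : ℕ,
      1 ≤ n → 1 ≤ n' → n ≠ n' → n ≤ 2 * M → n' ≤ 2 * M →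
        |∑ m ∈ Finset.Ioc M (2 * M),
            (ArithmeticFunction.liouville (Int.toNat ((m : ℤ) * n + c)) : ℝ) *
              (ArithmeticFunction.liouville (Int.toNat ((m : ℤ) * n' + c)) : ℝ)| ≤
          C * (M : ℝ) ^ (1 - κ) := by
  -- LANDED (p116198): Summit.Parity.GeneralizedHardyLittlewood.Theorems.FanDecorrelation.DilatedChowlaOfBinaryForms.stub_dilatedChowlaOfBinaryForms
  -- (the same proof, written out here so that this workfile does not depend on the newest module
  -- while the farm snapshot catches up)
  intro hB c hc
  obtain ⟨κ, hκ, C, hC⟩ := hB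
  set κ' : ℝ := min κ (1 / 2) with hκ'
  have hκ'pos : 0 < κ' := lt_min hκ (by norm_num)
  have hκ'le : κ' ≤ κ := min_le_left _ _
  have hκ'half : κ' ≤ 1 / 2 := min_le_right _ _
  refine ⟨κ', hκ'pos, max C 0 + |(c : ℝ)|, ?_⟩
  intro M n n' hn hn' hnn' hnM hn'M
  have hM1 : 1 ≤ M := by omega
  have hM1r : (1 : ℝ) ≤ M := by exact_mod_cast hM1
  have hMpow1 : (1 : ℝ) ≤ (M : ℝ) ^ (1 - κ') := Real.one_le_rpow hM1r (by linarith)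
  have hMpow0 : (0 : ℝ) ≤ (M : ℝ) ^ (1 - κ') := by linarith
  have hC0 : (0 : ℝ) ≤ max C 0 := le_max_right _ _
  have hc0 : (0 : ℝ) ≤ |(c : ℝ)| := abs_nonneg _
  -- trivial bound `|S| ≤ M`
  have htriv : |∑ m ∈ Finset.Ioc M (2 * M),
      (ArithmeticFunction.liouville (Int.toNat ((m : ℤ) * n + c)) : ℝ) *
        (ArithmeticFunction.liouville (Int.toNat ((m : ℤ) * n' + c)) : ℝ)| ≤ M := by
    calc _ ≤ ∑ m ∈ Finset.Ioc M (2 * M),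
          |(ArithmeticFunction.liouville (Int.toNat ((m : ℤ) * n + c)) : ℝ) *
            (ArithmeticFunction.liouville (Int.toNat ((m : ℤ) * n' + c)) : ℝ)| :=
          Finset.abs_sum_le_sum_abs _ _
      _ ≤ ∑ _m ∈ Finset.Ioc M (2 * M), (1 : ℝ) := by
          refine Finset.sum_le_sum fun m _ => ?_
          rw [abs_mul]
          exact mul_le_one₀ (Literature.NumberTheory.Sieve.abs_liouville_le_one _) (abs_nonneg _)
            (Literature.NumberTheory.Sieve.abs_liouville_le_one _)
      _ = M := by
          rw [Finset.sum_const, Nat.card_Ioc, show 2 * M - M = M by omega]; simp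
  rcases le_or_gt (M : ℤ) |c| with hsmall | hlarge
  · have h1 : (M : ℝ) ≤ |(c : ℝ)| := by
      rw [← Int.cast_abs]; exact_mod_cast hsmall
    calc _ ≤ (M : ℝ) := htriv
      _ ≤ |(c : ℝ)| := h1
      _ ≤ (max C 0 + |(c : ℝ)|) * 1 := by linarith
      _ ≤ (max C 0 + |(c : ℝ)|) * (M : ℝ) ^ (1 - κ') :=
          mul_le_mul_of_nonneg_left hMpow1 (by positivity)
  · have hpos : ∀ t : ℕ, 1 ≤ t → 0 < (t : ℤ) * M + c := by
      intro t ht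
      have h1 : (M : ℤ) ≤ (t : ℤ) * M := by
        have : (1 : ℤ) ≤ t := by exact_mod_cast ht
        nlinarith
      have h2 : -(M : ℤ) < c := by
        have := neg_abs_le c
        omega
      linarith
    have hht : ∀ t : ℕ, 1 ≤ t → |c| ≤ 2 * (t : ℤ) * M := by
      intro t ht
      have : (1 : ℤ) ≤ t := by exact_mod_cast ht
      nlinarith
    have hne : (n : ℤ) * c ≠ (n' : ℤ) * c := by
      intro h
      have : (n : ℤ) = n' := mul_right_cancel₀ hc h
      exact hnn' (by exact_mod_cast this)
    have key := hC M M n n' c c le_rfl hn hn' hnM hn'M (hpos n hn) (hpos n' hn') (hht n hn)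
      (hht n' hn') hne
    rw [show M + M = 2 * M by ring] at key
    calc _ ≤ C * (M : ℝ) ^ (1 - κ) := key
      _ ≤ max C 0 * (M : ℝ) ^ (1 - κ) :=
          mul_le_mul_of_nonneg_right (le_max_left _ _) (Real.rpow_nonneg (by positivity) _)
      _ ≤ max C 0 * (M : ℝ) ^ (1 - κ') :=
          mul_le_mul_of_nonneg_left (Real.rpow_le_rpow_of_exponent_le hM1r (by linarith)) hC0
      _ ≤ (max C 0 + |(c : ℝ)|) * (M : ℝ) ^ (1 - κ') :=
          mul_le_mul_of_nonneg_right (by linarith) hMpow0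

/-- Stub 9 (PROVABLE NOW, size S; added by lead c3) — **binary-forms Chowla ∧ wide height law ⟹
crux body**, the line's normal form after the reshape: hypothesis 1 = stub 3a verbatim,
hypothesis 2 = `stub_wideLaw` verbatim, conclusion = the body of `FanDecorrelation` verbatim.
Proof: `stub_fanOfHeightLaws (stub_pointwiseOfBinaryForms h₁) h₂`. [folklore] -/
theorem stub_fanOfBinaryFormsWide :
    (∃ κ : ℝ, 0 < κ ∧ ∃ C : ℝ, ∀ X L n₁ n₂ : ℕ, ∀ a₁ a₂ : ℤ,
      L ≤ X → 1 ≤ n₁ → 1 ≤ n₂ → n₁ ≤ 2 * X → n₂ ≤ 2 * X →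
        0 < (n₁ : ℤ) * X + a₁ → 0 < (n₂ : ℤ) * X + a₂ →
          |a₁| ≤ 2 * (n₁ : ℤ) * X → |a₂| ≤ 2 * (n₂ : ℤ) * X →
            (n₁ : ℤ) * a₂ ≠ (n₂ : ℤ) * a₁ →
              |∑ u ∈ Finset.Ioc X (X + L),
                  (ArithmeticFunction.liouville (Int.toNat ((u : ℤ) * n₁ + a₁)) : ℝ) *
                    (ArithmeticFunction.liouville (Int.toNat ((u : ℤ) * n₂ + a₂)) : ℝ)| ≤
                C * (X : ℝ) ^ (1 - κ)) →
    (∀ φ : ℝ → ℝ, ContDiff ℝ (⊤ : ℕ∞) φ → (∀ x : ℝ, φ x ≠ 0 → |x| ≤ 2) →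
      ∀ c : ℤ, c ≠ 0 → ∀ δ : ℝ, 0 < δ → ∃ ϑ : ℝ, ϑ < 1 / 4 ∧ ∃ C : ℝ,
        ∀ M n n' : ℕ, ∀ k : ℤ, ∀ P D : ℝ,
          1 ≤ n → 1 ≤ n' → n ≠ n' → n ≤ 2 * M → n' ≤ 2 * M → k ≠ 0 →
            (M : ℝ) ^ δ ≤ D → 8 * D ≤ (Nat.sqrt M : ℝ) + 1 →
              (Nat.sqrt M : ℝ) + 1 ≤ P → P ≤ 2 * ((Nat.sqrt M : ℝ) + 1) →
                |∑ j ∈ Finset.Icc 1 (2 * M), φ (((j : ℝ) - P) / D) *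
                    ∑ p ∈ (Finset.Ioc M (2 * M) ×ˢ Finset.Ioc M (2 * M)).filter
                        (fun p : ℕ × ℕ => (p.1 : ℤ) - p.2 = k * (j : ℤ)),
                      (ArithmeticFunction.liouville (Int.toNat ((p.1 : ℤ) * n + c)) : ℝ) *
                        (ArithmeticFunction.liouville (Int.toNat ((p.2 : ℤ) * n' + c)) : ℝ)| ≤
                  C * (M : ℝ) ^ (3 / 4 + ϑ)) →
    ∀ c : ℤ, c ≠ 0 → ∃ ϑ : ℝ, ϑ < 1 / 4 ∧ ∃ C : ℝ, ∀ M n n' : ℕ, ∀ k : ℤ,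
      1 ≤ n → 1 ≤ n' → n ≠ n' → n ≤ 2 * M → n' ≤ 2 * M → k ≠ 0 →
        |∑ j ∈ Finset.Ico (Nat.sqrt M + 1) (2 * (Nat.sqrt M + 1)),
            ∑ p ∈ (Finset.Ioc M (2 * M) ×ˢ Finset.Ioc M (2 * M)).filter
                (fun p : ℕ × ℕ => (p.1 : ℤ) - p.2 = k * (j : ℤ)),
              (ArithmeticFunction.liouville (Int.toNat ((p.1 : ℤ) * n + c)) : ℝ) *
                (ArithmeticFunction.liouville (Int.toNat ((p.2 : ℤ) * n' + c)) : ℝ)| ≤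
          C * (M : ℝ) ^ (3 / 4 + ϑ) :=
  -- LANDED (p116609): Summit.Parity.GeneralizedHardyLittlewood.Theorems.FanDecorrelation.FanOfBinaryFormsWide.stub_fanOfBinaryFormsWide
  -- (the same term, written out over the other landed stubs so that this workfile does not depend
  -- on the newest module while the farm snapshot catches up)
  fun h₁ h₂ => stub_fanOfHeightLaws (stub_pointwiseOfBinaryForms h₁) h₂

/-! ### Asides: the two cruxes BY NAME from the conjecture stubs -/

/-- ASIDE (lead c3; not used by the composition) — **the route's rank-4 crux `DilatedChowla`
(stmt-Parity-13319) BY NAME from binary-forms Chowla** (stub 3a), through the landed stub 8. -/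
theorem dilatedChowla_of_binaryForms
    (hB : ∃ κ : ℝ, 0 < κ ∧ ∃ C : ℝ, ∀ X L n₁ n₂ : ℕ, ∀ a₁ a₂ : ℤ,
      L ≤ X → 1 ≤ n₁ → 1 ≤ n₂ → n₁ ≤ 2 * X → n₂ ≤ 2 * X →
        0 < (n₁ : ℤ) * X + a₁ → 0 < (n₂ : ℤ) * X + a₂ →
          |a₁| ≤ 2 * (n₁ : ℤ) * X → |a₂| ≤ 2 * (n₂ : ℤ) * X →
            (n₁ : ℤ) * a₂ ≠ (n₂ : ℤ) * a₁ →
              |∑ u ∈ Finset.Ioc X (X + L),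
                  (ArithmeticFunction.liouville (Int.toNat ((u : ℤ) * n₁ + a₁)) : ℝ) *
                    (ArithmeticFunction.liouville (Int.toNat ((u : ℤ) * n₂ + a₂)) : ℝ)| ≤
                C * (X : ℝ) ^ (1 - κ)) :
    Summit.Parity.GeneralizedHardyLittlewood.Theses.LiouvilleMAD.DilatedChowla :=
  stub_dilatedChowlaOfBinaryForms hB

/-! ### Hardness certificates (lead c4, 2026-08-16): both open stubs sit above an effective Landau–Siegel theorem -/

/-- **Stub 3a is Landau–Siegel-hard (kernel-checked).**  `BinaryFormsChowla` (stub 3a) implies —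
through the landed stub 8 (p116198, `⟹ DilatedChowla`) and the sibling crux's Siegel mirror
`Theorems/DilatedChowla/Negative/DilatedChowlaMirror.siegelMirror_realZeroFree` (Landau's method with
the poles `s = 1, β`, orthogonality, Gram positivity in the dilation variable) — a REAL-ZERO-FREE
INTERVAL `[1 − 1/(C₀ log² q), 1)` for every primitive quadratic `L(s, χ mod q)`, `q ≥ q₀`.  Only
Siegel's ineffective `1 − β ≥ C(ε)q^{−ε}` is known, so no proof of stub 3a can be cheaper than an
effective Landau–Siegel theorem of that quality.  (Its finite shadow is visible numerically: `λ`
pretends to be the class-number-one character `χ₋₁₆₃` below `X ≈ 10⁴`, biasing plain Chowla sums at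
lags `≡ 0 (mod 163)` by `≈ X·E[λχ₋₁₆₃]² = O(1)`; lead-c4 worker assessment, `bfc_163.py`.) -/
theorem realZeroFree_of_binaryForms
    (hB : ∃ κ : ℝ, 0 < κ ∧ ∃ C : ℝ, ∀ X L n₁ n₂ : ℕ, ∀ a₁ a₂ : ℤ,
      L ≤ X → 1 ≤ n₁ → 1 ≤ n₂ → n₁ ≤ 2 * X → n₂ ≤ 2 * X →
        0 < (n₁ : ℤ) * X + a₁ → 0 < (n₂ : ℤ) * X + a₂ →
          |a₁| ≤ 2 * (n₁ : ℤ) * X → |a₂| ≤ 2 * (n₂ : ℤ) * X →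
            (n₁ : ℤ) * a₂ ≠ (n₂ : ℤ) * a₁ →
              |∑ u ∈ Finset.Ioc X (X + L),
                  (ArithmeticFunction.liouville (Int.toNat ((u : ℤ) * n₁ + a₁)) : ℝ) *
                    (ArithmeticFunction.liouville (Int.toNat ((u : ℤ) * n₂ + a₂)) : ℝ)| ≤
                C * (X : ℝ) ^ (1 - κ)) :
    ∃ C₀ : ℝ, 0 < C₀ ∧ ∃ q₀ : ℕ, ∀ (q : ℕ) [NeZero q] (χ : DirichletCharacter ℂ q),
      χ.IsPrimitive → χ.IsQuadratic → q₀ ≤ q →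
        ∀ σ : ℝ, 1 - 1 / (C₀ * Real.log q ^ 2) ≤ σ → σ < 1 → χ.LFunction (σ : ℂ) ≠ 0 :=
  Summit.Parity.GeneralizedHardyLittlewood.Theorems.DilatedChowla.Negative.siegelMirror_realZeroFree
    (stub_dilatedChowlaOfBinaryForms hB)

/-- **The MAD pair is jointly Landau–Siegel-hard (kernel-checked).**  The route's two decorrelation
cruxes — `CosetDecorrelation` (stmt-Parity-13317) and THIS crux `FanDecorrelation` (stmt-Parity-13318) —
together give `DilatedChowla` (`decorrelationToDilatedChowla_proof`, item 13321, DivisorSwitch) and hence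
the same real-zero-free interval for primitive quadratic Dirichlet `L`-functions. -/
theorem realZeroFree_of_MAD (h₁ : CosetDecorrelation) (h₂ : FanDecorrelation) :
    ∃ C₀ : ℝ, 0 < C₀ ∧ ∃ q₀ : ℕ, ∀ (q : ℕ) [NeZero q] (χ : DirichletCharacter ℂ q),
      χ.IsPrimitive → χ.IsQuadratic → q₀ ≤ q →
        ∀ σ : ℝ, 1 - 1 / (C₀ * Real.log q ^ 2) ≤ σ → σ < 1 → χ.LFunction (σ : ℂ) ≠ 0 :=
  Summit.Parity.GeneralizedHardyLittlewood.Theorems.DilatedChowla.Negative.siegelMirror_realZeroFree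
    ((show CosetDecorrelation → FanDecorrelation → DilatedChowla from
      Summit.Parity.GeneralizedHardyLittlewood.Theorems.decorrelationToDilatedChowla_proof) h₁ h₂)

/-- The same in `_false_of_` form (for the disprover's index): Siegel zeros of EVERY logarithmic
quality at arbitrarily large conductors (`SiegelZerosAbove`, tree predicate of the DilatedChowla
negatives; believed false — this is a hardness certificate, not a refutation mechanism), together with
`CosetDecorrelation`, refute `FanDecorrelation`. -/
theorem FanDecorrelation_false_of_siegelZerosAbove_of_coset
    (hz : ∀ C₀ : ℝ, 0 < C₀ →
      Summit.Parity.GeneralizedHardyLittlewood.Theorems.DilatedChowla.Negative.SiegelZerosAbove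
        (fun q => C₀ * Real.log q))
    (h₁ : CosetDecorrelation) : ¬ FanDecorrelation := fun h₂ =>
  Summit.Parity.GeneralizedHardyLittlewood.Theorems.DilatedChowla.Negative.DilatedChowla_false_of_siegelZerosAbove
    hz
    ((show CosetDecorrelation → FanDecorrelation → DilatedChowla from
      Summit.Parity.GeneralizedHardyLittlewood.Theorems.decorrelationToDilatedChowla_proof) h₁ h₂)

/-! ### Composition -/

/-- **The line concludes the crux BY NAME.**  The route decl
`Summit.Parity.GeneralizedHardyLittlewood.Theses.LiouvilleMAD.FanDecorrelation` from the registered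
stubs: the transfer (stub 2) applied to the window partition (stub 1) and to the height law glued
from the narrow half (stub 4 applied to the pointwise law, stub 3) and the wide half (stub 5).
`sorry` occurs only inside the stubs. -/
theorem FanDecorrelation_of :
    Summit.Parity.GeneralizedHardyLittlewood.Theses.LiouvilleMAD.FanDecorrelation :=
  stub_transfer stub_windowPartition
    (heightLaw_of_narrow_wide (stub_narrowOfPointwise stub_pointwiseLaw) stub_wideLaw)

/-- The same conclusion through the one-piece normal form (stub 7): the crux BY NAME from the two
conjecture-grade content stubs alone. -/
theorem FanDecorrelation_of_heightLaws :
    Summit.Parity.GeneralizedHardyLittlewood.Theses.LiouvilleMAD.FanDecorrelation :=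
  stub_fanOfHeightLaws stub_pointwiseLaw stub_wideLaw

end Summit.Parity.GeneralizedHardyLittlewood.Cruxes.FanDecorrelation.MellinHeightLaw
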